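import Summits.HodgeConjecture.HodgeConjecture.Theorems.HodgeLocusCensusUnitColumnRankLevelsPowers

/-!
# Hodge locus census — the chain law, the Frobenius complex and the Gorenstein duality of the multiplicity matrices (PROBE 30)

certified instances and evidence bearing on the general Hodge conjecture; no claim.  Theorem-only helper sheet of the unit-column line
(gen 31's `…ModelNonJumpC1All` (`colR`), anchors 229 `…UnitColumnRankLevelsPowers` (`count_iterate_colR`), 312 `…UnitColumnRankLevelSymmetry`,
340 `…UnitColumnRankDropExact`); nothing here is a statement about Hodge loci.

WHAT.  `A = K[x₁,…,x_k]/(xᵢ^{e+2})`, `q = Σᵢ xᵢ^{e+1}`, and anchor 229's MULTIPLICITY MATRICES, verbatim: for exponent functions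
`v, m : Fin k → Fin (e+2)` the entry at `(v, m)` of the matrix of `×q^c` is the multiplicity of `List.ofFn v` in the `c`-fold column expansion
`(List.flatMap (colR (e+3)))^[c] [List.ofFn m]` (cast `ℕ → R`), rows of codegree `j` (`Σ v + j = k(e+1)`), columns of codegree `j + c(e+1)`.
Anchor 229's `count_iterate_colR` evaluates every entry: `c! · [v ≡ m (mod e+1) pointwise ∧ Z(v) ⊆ Z(m) ∧ |Z(m)| = |Z(v)| + c]` (`Z` = zero set).
This sheet proves the three STRUCTURE LAWS of these matrices that the line has so far used only through their rank shadows — at EVERY level,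
with NO window hypothesis:
  §1 (CHAIN) `chain_law` — over every semiring, for all `a, b` and all codegrees `j, J`:
       `M_a(j → J) * M_b(J → J + b(e+1)) = M_{a+b}(j → J + b(e+1))`
     (`M_a(j → J)` = the multiplicity matrix with rows of codegree `j` and columns of codegree `J`; it is anchor 229's matrix of `×q^a` when
     `J = j + a(e+1)` and the zero matrix otherwise, and the law holds either way).  This is `q^a · q^b = q^{a+b}` IN ANCHOR 229's LIST MODEL, where
     it is not a tautology: the matrices are defined by path counts in iterated column expansions, and the law is the path-concatenation identity
     (CHAIN-ℕ) `Σ_w mult_a(v, w) · mult_b(w, m) = mult_{a+b}(v, m)` (`Function.iterate_add_apply`, anchor 229's `iterate_flatMap_eq`,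
     `List.count_flatMap`, and `sum_map_eq_sum_mul_count`: a multiplicity-weighted sum over the produced list is a sum over the exponent functions
     of the middle codegree, because every produced monomial is one of them, `exists_eq_ofFn_of_mem_iterate`).
  §2 (CX) over a field `K` of prime characteristic `p`:  (CX0) `eq_zero_of_prime_le` — `M_a = 0` for `p ≤ a` (`p ∣ a!`; `q^p = Σᵢ xᵢ^{p(e+1)} = 0`
     on `A`);  (CX) `mul_eq_zero_of_prime_le` — `M_a(j → J) * M_b(J → J + b(e+1)) = 0` for `p ≤ a + b` ((CHAIN) + (CX0));  (CX-range)
     `range_le_ker_of_prime_le` — `range (M_a(j → J)).vecMulLinear ≤ ker (M_b(J → J + b(e+1))).vecMulLinear`: THE CENSUS LADDER OF ROW SPACES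
     `… → K^{codeg j} →(M_a) K^{codeg J} →(M_b) K^{codeg J + b(e+1)} → …` IS A COMPLEX IN CHARACTERISTIC `p` whenever `a + b ≥ p`, at every level.
     With `(a, b) = (p − c, c)` and `J = j + (p−c)(e+1)` the two matrices are anchor 229's matrices of `×q^{p−c}` at `j` and of `×q^c` at `J` (the
     terms of anchor 340 §3 (EX), there in rank form), and the quotient `ker / range` is the census homology at `J` whose dimension the census Betti
     law computes (PROBE 29 `UnitColumnBetti.finrank_ker_add_eq`: after the substitution its range and kernel are these, term for term); anchor 340
     (EX-ker) proved `range = ker` below the middle in the inclusion-block model — this is the hypothesis-free container statement at census level.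
  §3 (DUAL) `transpose_eq_dual` — over every semiring, for dual levels `j + j' + c(e+1) = k(e+1)`:
       `(M_c(j))ᵀ = M_c(j')` re-indexed along `v ↦ top − v` on rows and columns (`top = (e+1, …, e+1)`, `Fin.rev` on `Fin (e+2)`; `Matrix.submatrix`),
     from the entry-level duality (DUAL-ℕ) `count_iterate_colR_dual`: for ALL `v, m` (no hypothesis) the multiplicity of `x^v` in `q^c · x^m` equals the
     multiplicity of `x^{top−m}` in `q^c · x^{top−v}` — anchor 229's closed form is self-dual: the label relation is symmetric under `top − ·`
     (`mod_eq_iff_dual`) and duality exchanges zero sets with top sets, reversing the inclusion and keeping the cardinality gap (`zeros_dual`).  This is the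
     Poincaré / Gorenstein duality of the monomial complete intersection `A` (socle degree `k(e+1)`) as an identity of anchor 229's matrices; anchor 312
     (PROBE 20) proved its rank shadow `rank(c, j) = rank(c, j')` over every field from anchor 294's block formula «without any duality» — here is the
     duality, and with it the transpose pairing of left and right kernels at dual levels that the Betti line can use past the middle.
NUMERICS FIRST (owner, file-backed under `HOME/pub-hlocus-ivhs-2/gen58/probe30/`): `chain_numerics.py` → `chain_local.out` (k ≤ 4, e ≤ 2, a + b ≤ 4)
and ONE kit job `kit30.py` = j282284 (k ≤ 8, e ≤ 4, a + b ≤ 7; pure-Python exact sparse integer matrices, no numpy): (K1) the LITERAL list-iteration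
matrices = the constructive form of `count_iterate_colR` (raise an `a`-subset of `Z(m)`) entry for entry and (K1b) = its closed-form predicate, (K4) every
non-zero literal multiplicity equals `a!`, (K2) (CHAIN) as exact integer matrix products at every level, (K3) every entry of `M_p` divisible by `p`
(`p = 2, 3, 5`), (K5) over `GF(p)` the products `N_{p−c}(j) · N_c(J)` of the `0/1` matrices `N_a = M_a / a!` vanish — 0 violations; `dual_numerics.py` →
`dual_local.out` (k ≤ 4, e ≤ 2, c ≤ 3) and ONE kit job j282793 (k ≤ 5, e ≤ 3, c ≤ 5): (D1) (DUAL-ℕ) on LITERAL lists for ALL pairs `(v, m)`, (D2) the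
transpose law with its index bijections at every level — 0 violations.  Instance counts are in the READY line.
LITERATURE (context only; nothing imported or minted): functoriality and Poincaré duality of the graded Artinian complete intersection `A` are textbook
commutative algebra; the `p`-complex `q^{p−c} ∘ q^c = 0` is the census form of the Boolean inclusion complex of anchor 340's header (Mnukhin–Siemons 1996,
there cited).  No literature fact is used as a hypothesis.
EVIDENCE CLASS: kernel theorems about the census matrices; no census number changes; nothing here asserts anything about the Hodge conjecture.

Import: anchor 229 `…Theorems.HodgeLocusCensusUnitColumnRankLevelsPowers` BY NAME (hence `colR`); theorem-only, definition-free.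
-/

set_option linter.dupNamespace false
set_option autoImplicit false

namespace Summit.HodgeConjecture.HodgeConjecture.HodgeLocus.Census.UnitColumnChain

open Summit.HodgeConjecture.HodgeConjecture.HodgeLocus.Census.ModelNonJumpC1All (colR)
open Summit.HodgeConjecture.HodgeConjecture.HodgeLocus.Census.UnitColumnRankLevelsPowers (iterate_flatMap_eq colR_toFinset count_iterate_colR)

/-! ## §1 (CHAIN): the multiplicity matrices compose -/

/-- raising a zero coordinate to the top exponent `e + 1` adds `e + 1` to the degree -/
theorem degree_update_eq {k e : ℕ} (m : Fin k → Fin (e + 2)) (i : Fin k) (hi : (m i : ℕ) = 0) :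
    (∑ l, ((Function.update m i (Fin.last (e + 1)) l : Fin (e + 2)) : ℕ)) = (∑ l, (m l : ℕ)) + (e + 1) := by
  have h1 : ∀ l, ((Function.update m i (Fin.last (e + 1)) l : Fin (e + 2)) : ℕ) =
      Function.update (fun l => (m l : ℕ)) i (e + 1) l := by
    intro l
    rw [Function.update_apply, Function.update_apply]
    by_cases hl : l = i
    · rw [if_pos hl, if_pos hl, Fin.val_last]
    · rw [if_neg hl, if_neg hl]
  simp_rw [h1]
  rw [Finset.sum_update_of_mem (Finset.mem_univ i), Finset.sdiff_singleton_eq_erase]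
  have h2 := Finset.add_sum_erase Finset.univ (fun l => (m l : ℕ)) (Finset.mem_univ i)
  simp only [hi] at h2
  omega

/-- every monomial of the `b`-fold column expansion of `x^m` is `x^w` for an exponent function `w` of degree `deg m + b(e+1)`
(induction on `b`: anchor 229's `iterate_flatMap_eq` and `colR_toFinset`, then `degree_update_eq`) -/
theorem exists_eq_ofFn_of_mem_iterate {k e : ℕ} (b : ℕ) : ∀ (m : Fin k → Fin (e + 2)) (x : List ℕ),
    x ∈ (List.flatMap (colR (e + 3)))^[b] [List.ofFn (fun i => (m i : ℕ))] →
      ∃ w : Fin k → Fin (e + 2), x = List.ofFn (fun i => (w i : ℕ)) ∧ (∑ i, (w i : ℕ)) = (∑ i, (m i : ℕ)) + b * (e + 1) := by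
  induction b with
  | zero =>
    intro m x hx
    rw [Function.iterate_zero_apply, List.mem_singleton] at hx
    exact ⟨m, hx, by ring⟩
  | succ b ih =>
    intro m x hx
    rw [Function.iterate_succ_apply, List.flatMap_singleton, iterate_flatMap_eq, List.mem_flatMap] at hx
    obtain ⟨y, hy, hxy⟩ := hx
    have hy' := List.mem_toFinset.mpr hy
    rw [colR_toFinset, Finset.mem_image] at hy'
    obtain ⟨i, hi, hyi⟩ := hy'
    simp only [Finset.mem_filter, Finset.mem_univ, true_and] at hi
    rw [← hyi] at hxy
    obtain ⟨w, hw, hsum⟩ := ih _ x hxy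
    refine ⟨w, hw, ?_⟩
    rw [hsum, degree_update_eq m i hi]
    ring

/-- a multiplicity-weighted sum over a list of monomials is a sum over the exponent functions naming them: for an injective naming `φ` and a
list `L` all of whose members are named, `Σ_{x ∈ L} g x = Σ_w g (φ w) · count (φ w) L` (list induction; stated for the default `BEq` of the
matrix entries, so that it rewrites them literally) -/
theorem sum_map_eq_sum_mul_count {S : Type*} [Fintype S] (φ : S → List ℕ) (hφ : Function.Injective φ) (g : List ℕ → ℕ) :
    ∀ L : List (List ℕ), (∀ x ∈ L, ∃ w, x = φ w) → (L.map g).sum = ∑ w, g (φ w) * L.count (φ w) := by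
  classical
  intro L
  induction L with
  | nil => intro _; simp
  | cons x L ih =>
    intro h
    obtain ⟨w₀, hw₀⟩ := h x (List.mem_cons.mpr (Or.inl rfl))
    rw [List.map_cons, List.sum_cons, ih (fun y hy => h y (List.mem_cons.mpr (Or.inr hy))), hw₀]
    simp only [List.count_cons, mul_add, Finset.sum_add_distrib, beq_iff_eq, hφ.eq_iff, mul_ite, mul_one, mul_zero, Finset.sum_ite_eq,
      Finset.mem_univ, if_true]
    ring

/-- **(CHAIN-ℕ)** the multiplicities compose: for `v` of codegree `j`, `m` of codegree `J + b(e+1)` and the middle sum over the exponent functions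
`w` of codegree `J`, `Σ_w mult_a(v, w) · mult_b(w, m) = mult_{a+b}(v, m)` — `q^{a+b} · x^m` expanded as `q^a · (q^b · x^m)` path by path
(`Function.iterate_add_apply`, `iterate_flatMap_eq`, `List.count_flatMap`, `sum_map_eq_sum_mul_count`, `exists_eq_ofFn_of_mem_iterate`). -/
theorem sum_count_mul_count_eq {k e : ℕ} (a b j J : ℕ) (v : {v : Fin k → Fin (e + 2) // (∑ i, (v i : ℕ)) + j = k * (e + 1)})
    (m : {m : Fin k → Fin (e + 2) // (∑ i, (m i : ℕ)) + (J + b * (e + 1)) = k * (e + 1)}) :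
    (∑ w : {w : Fin k → Fin (e + 2) // (∑ i, (w i : ℕ)) + J = k * (e + 1)},
      ((List.flatMap (colR (e + 3)))^[a] [List.ofFn (fun i => (w.1 i : ℕ))]).count (List.ofFn (fun i => (v.1 i : ℕ))) *
        ((List.flatMap (colR (e + 3)))^[b] [List.ofFn (fun i => (m.1 i : ℕ))]).count (List.ofFn (fun i => (w.1 i : ℕ)))) =
      ((List.flatMap (colR (e + 3)))^[a + b] [List.ofFn (fun i => (m.1 i : ℕ))]).count (List.ofFn (fun i => (v.1 i : ℕ))) := by
  rw [Function.iterate_add_apply]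
  set L := (List.flatMap (colR (e + 3)))^[b] [List.ofFn (fun i => (m.1 i : ℕ))] with hL
  rw [iterate_flatMap_eq (colR (e + 3)) a L, List.count_flatMap,
    sum_map_eq_sum_mul_count (fun w : {w : Fin k → Fin (e + 2) // (∑ i, (w i : ℕ)) + J = k * (e + 1)} =>
      List.ofFn (fun i => (w.1 i : ℕ))) (fun w₁ w₂ h => Subtype.ext (funext (fun i => Fin.ext (congrFun (List.ofFn_inj.mp h) i)))) _ L
      (fun x hx => ?_)]
  · simp only [Function.comp_apply]
  · obtain ⟨w, hw, hsum⟩ := exists_eq_ofFn_of_mem_iterate b m.1 x hx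
    have hm := m.2
    exact ⟨⟨w, by omega⟩, hw⟩

/-- **(CHAIN) THE CENSUS CHAIN LAW.** For every semiring `R` and all `k, e, a, b, j, J`: the multiplicity matrix of the `a`-fold column expansion
from codegree `J` to codegree `j`, times that of the `b`-fold expansion from codegree `J + b(e+1)` to codegree `J`, IS the multiplicity matrix of the
`(a+b)`-fold expansion from codegree `J + b(e+1)` to codegree `j` — for `J = j + a(e+1)` these are anchor 229's matrices of `×q^a`, `×q^b`, `×q^{a+b}`
(`(×q^a) ∘ (×q^b) = ×q^{a+b}` in the list model), for other `J` the first and the last matrix vanish.  Proof: (CHAIN-ℕ) entry by entry. -/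
theorem chain_law (R : Type*) [Semiring R] (k e a b j J : ℕ) :
    (Matrix.of fun (v : {v : Fin k → Fin (e + 2) // (∑ i, (v i : ℕ)) + j = k * (e + 1)})
        (m : {m : Fin k → Fin (e + 2) // (∑ i, (m i : ℕ)) + J = k * (e + 1)}) =>
      ((((List.flatMap (colR (e + 3)))^[a] [List.ofFn (fun i => (m.1 i : ℕ))]).count (List.ofFn (fun i => (v.1 i : ℕ))) : ℕ) : R)) *
    (Matrix.of fun (v : {v : Fin k → Fin (e + 2) // (∑ i, (v i : ℕ)) + J = k * (e + 1)})
        (m : {m : Fin k → Fin (e + 2) // (∑ i, (m i : ℕ)) + (J + b * (e + 1)) = k * (e + 1)}) =>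
      ((((List.flatMap (colR (e + 3)))^[b] [List.ofFn (fun i => (m.1 i : ℕ))]).count (List.ofFn (fun i => (v.1 i : ℕ))) : ℕ) : R)) =
    Matrix.of fun (v : {v : Fin k → Fin (e + 2) // (∑ i, (v i : ℕ)) + j = k * (e + 1)})
        (m : {m : Fin k → Fin (e + 2) // (∑ i, (m i : ℕ)) + (J + b * (e + 1)) = k * (e + 1)}) =>
      ((((List.flatMap (colR (e + 3)))^[a + b] [List.ofFn (fun i => (m.1 i : ℕ))]).count (List.ofFn (fun i => (v.1 i : ℕ))) : ℕ) : R) := by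
  ext v m
  rw [Matrix.mul_apply, Matrix.of_apply, ← sum_count_mul_count_eq a b j J v m, Nat.cast_sum]
  exact Finset.sum_congr rfl (fun w _ => by rw [Matrix.of_apply, Matrix.of_apply, Nat.cast_mul])

/-! ## §2 (CX): the census is a complex in characteristic `p` -/

/-- **(CX0)** over a field of prime characteristic `p ≤ a`, the multiplicity matrix of the `a`-fold column expansion (any row and column codegrees
`j`, `J`) is ZERO: by anchor 229's `count_iterate_colR` every entry is `a! · [⋯]` and `p ∣ a!` — `q^p = Σᵢ xᵢ^{p(e+1)} = 0` on `K[x]/(xᵢ^{e+2})`. -/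
theorem eq_zero_of_prime_le (K : Type*) [Field K] (p : ℕ) [CharP K p] (hp : p.Prime) (k e a j J : ℕ) (hpa : p ≤ a) :
    (Matrix.of fun (v : {v : Fin k → Fin (e + 2) // (∑ i, (v i : ℕ)) + j = k * (e + 1)})
        (m : {m : Fin k → Fin (e + 2) // (∑ i, (m i : ℕ)) + J = k * (e + 1)}) =>
      ((((List.flatMap (colR (e + 3)))^[a] [List.ofFn (fun i => (m.1 i : ℕ))]).count (List.ofFn (fun i => (v.1 i : ℕ))) : ℕ) : K)) = 0 := by
  ext v m
  rw [Matrix.of_apply, Matrix.zero_apply, count_iterate_colR a m.1 v.1]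
  split_ifs
  · exact (CharP.cast_eq_zero_iff K p _).mpr (hp.dvd_factorial.mpr hpa)
  · exact Nat.cast_zero

/-- **(CX) THE CENSUS IS A COMPLEX IN CHARACTERISTIC `p`.** Over a field of prime characteristic `p ≤ a + b`, the product of the multiplicity
matrices of the `a`-fold and the `b`-fold column expansions (codegrees `j → J → J + b(e+1)`) VANISHES: by (CHAIN) it is the matrix of the
`(a+b)`-fold expansion, zero by (CX0).  In particular `M_{p−c}(j) · M_c(j + (p−c)(e+1)) = 0` and `M_c(j) · M_{p−c}(j + c(e+1)) = 0`. -/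
theorem mul_eq_zero_of_prime_le (K : Type*) [Field K] (p : ℕ) [CharP K p] (hp : p.Prime) (k e a b j J : ℕ) (hab : p ≤ a + b) :
    (Matrix.of fun (v : {v : Fin k → Fin (e + 2) // (∑ i, (v i : ℕ)) + j = k * (e + 1)})
        (m : {m : Fin k → Fin (e + 2) // (∑ i, (m i : ℕ)) + J = k * (e + 1)}) =>
      ((((List.flatMap (colR (e + 3)))^[a] [List.ofFn (fun i => (m.1 i : ℕ))]).count (List.ofFn (fun i => (v.1 i : ℕ))) : ℕ) : K)) *
    (Matrix.of fun (v : {v : Fin k → Fin (e + 2) // (∑ i, (v i : ℕ)) + J = k * (e + 1)})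
        (m : {m : Fin k → Fin (e + 2) // (∑ i, (m i : ℕ)) + (J + b * (e + 1)) = k * (e + 1)}) =>
      ((((List.flatMap (colR (e + 3)))^[b] [List.ofFn (fun i => (m.1 i : ℕ))]).count (List.ofFn (fun i => (v.1 i : ℕ))) : ℕ) : K)) = 0 := by
  rw [chain_law K k e a b j J]
  exact eq_zero_of_prime_le K p hp k e (a + b) j (J + b * (e + 1)) hab

/-- **(CX-range)** hence, for `p ≤ a + b`, the row space of the `a`-fold matrix (codegrees `j → J`) lies in the left kernel of the `b`-fold matrix
(codegrees `J → J + b(e+1)`): `range (M_a).vecMulLinear ≤ ker (M_b).vecMulLinear` (`Matrix.vecMul_vecMul` and (CX)).  With `(a, b) = (p − c, c)`,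
`J = j + (p−c)(e+1)` these are, term for term after the substitution, the range and the kernel of the census Betti law (PROBE 29
`UnitColumnBetti.finrank_ker_add_eq`; the matrices are anchor 229's, the terms of anchor 340 §3 (EX)), whose quotient is the census homology at `J`. -/
theorem range_le_ker_of_prime_le (K : Type*) [Field K] (p : ℕ) [CharP K p] (hp : p.Prime) (k e a b j J : ℕ) (hab : p ≤ a + b) :
    LinearMap.range (Matrix.vecMulLinear
      (Matrix.of fun (v : {v : Fin k → Fin (e + 2) // (∑ i, (v i : ℕ)) + j = k * (e + 1)})
          (m : {m : Fin k → Fin (e + 2) // (∑ i, (m i : ℕ)) + J = k * (e + 1)}) =>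
        ((((List.flatMap (colR (e + 3)))^[a] [List.ofFn (fun i => (m.1 i : ℕ))]).count (List.ofFn (fun i => (v.1 i : ℕ))) : ℕ) : K))) ≤
    LinearMap.ker (Matrix.vecMulLinear
      (Matrix.of fun (v : {v : Fin k → Fin (e + 2) // (∑ i, (v i : ℕ)) + J = k * (e + 1)})
          (m : {m : Fin k → Fin (e + 2) // (∑ i, (m i : ℕ)) + (J + b * (e + 1)) = k * (e + 1)}) =>
        ((((List.flatMap (colR (e + 3)))^[b] [List.ofFn (fun i => (m.1 i : ℕ))]).count (List.ofFn (fun i => (v.1 i : ℕ))) : ℕ) : K))) := by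
  rintro x ⟨y, rfl⟩
  rw [LinearMap.mem_ker, Matrix.vecMulLinear_apply, Matrix.vecMulLinear_apply, Matrix.vecMul_vecMul,
    mul_eq_zero_of_prime_le K p hp k e a b j J hab, Matrix.vecMul_zero]

/-! ## §3 (DUAL): the Gorenstein transpose — `x^v ↦ x^{top − v}` -/

/-- the dual exponent `e + 1 − x` of `x ≤ e + 1`, as `Fin.rev` on `Fin (e + 2)` -/
theorem val_dual_eq {e : ℕ} (x : Fin (e + 2)) : ((Fin.rev x : Fin (e + 2)) : ℕ) = e + 1 - (x : ℕ) := by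
  rw [Fin.val_rev]
  omega

/-- the dual monomial has the complementary degree: `deg (top − v) + deg v = k(e+1)` -/
theorem degree_dual_add_degree {k e : ℕ} (v : Fin k → Fin (e + 2)) :
    (∑ l, ((Fin.rev (v l) : Fin (e + 2)) : ℕ)) + ∑ l, (v l : ℕ) = k * (e + 1) := by
  rw [← Finset.sum_add_distrib, Finset.sum_congr rfl (fun l _ => show ((Fin.rev (v l) : Fin (e + 2)) : ℕ) + (v l : ℕ) = e + 1 from by
    rw [val_dual_eq]; have := (v l).isLt; omega), Finset.sum_const, Finset.card_univ, Fintype.card_fin, smul_eq_mul]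

/-- residues of `z ≤ e + 1` modulo `e + 1` -/
theorem mod_eq_ite {e : ℕ} (z : ℕ) (hz : z ≤ e + 1) : z % (e + 1) = if z = e + 1 then 0 else z := by
  split_ifs with h
  · rw [h, Nat.mod_self]
  · exact Nat.mod_eq_of_lt (by omega)

/-- duality preserves the label relation: `v ≡ m (mod e+1)` iff `top − m ≡ top − v (mod e+1)` -/
theorem mod_eq_iff_dual {e : ℕ} (x y : Fin (e + 2)) :
    (x : ℕ) % (e + 1) = (y : ℕ) % (e + 1) ↔ ((Fin.rev y : Fin (e + 2)) : ℕ) % (e + 1) = ((Fin.rev x : Fin (e + 2)) : ℕ) % (e + 1) := by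
  have hx := x.isLt
  have hy := y.isLt
  rw [val_dual_eq, val_dual_eq, mod_eq_ite (x : ℕ) (by omega), mod_eq_ite (y : ℕ) (by omega), mod_eq_ite (e + 1 - (y : ℕ)) (by omega),
    mod_eq_ite (e + 1 - (x : ℕ)) (by omega)]
  split_ifs <;> omega

/-- duality exchanges the zero sets `Z` with the top sets `T = Z ∘ dual` and reverses inclusions: with equal labels,
`Z(v) ⊆ Z(m) ∧ |Z(m)| = |Z(v)| + c` implies `T(m) ⊆ T(v) ∧ |T(v)| = |T(m)| + c` (and conversely, by applying this to the dual pair) -/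
theorem zeros_dual {k e c : ℕ} (v m : Fin k → Fin (e + 2)) (hlab : ∀ l, (v l : ℕ) % (e + 1) = (m l : ℕ) % (e + 1))
    (hZ : Finset.univ.filter (fun l => (v l : ℕ) = 0) ⊆ Finset.univ.filter (fun l => (m l : ℕ) = 0))
    (hcard : (Finset.univ.filter (fun l => (m l : ℕ) = 0)).card = (Finset.univ.filter (fun l => (v l : ℕ) = 0)).card + c) :
    Finset.univ.filter (fun l => ((Fin.rev (m l) : Fin (e + 2)) : ℕ) = 0) ⊆ Finset.univ.filter (fun l => ((Fin.rev (v l) : Fin (e + 2)) : ℕ) = 0) ∧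
      (Finset.univ.filter (fun l => ((Fin.rev (v l) : Fin (e + 2)) : ℕ) = 0)).card =
        (Finset.univ.filter (fun l => ((Fin.rev (m l) : Fin (e + 2)) : ℕ) = 0)).card + c := by
  have hpt : ∀ l, (v l : ℕ) = (m l : ℕ) ∨ ((v l : ℕ) = 0 ∧ (m l : ℕ) = e + 1) ∨ ((v l : ℕ) = e + 1 ∧ (m l : ℕ) = 0) := by
    intro l
    have h := hlab l
    have hv := (v l).isLt
    have hm := (m l).isLt
    rw [mod_eq_ite (v l : ℕ) (by omega), mod_eq_ite (m l : ℕ) (by omega)] at h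
    split_ifs at h <;> omega
  have hsub : Finset.univ.filter (fun l => ((Fin.rev (m l) : Fin (e + 2)) : ℕ) = 0) ⊆
      Finset.univ.filter (fun l => ((Fin.rev (v l) : Fin (e + 2)) : ℕ) = 0) := by
    intro l hl
    simp only [Finset.mem_filter, Finset.mem_univ, true_and, val_dual_eq] at hl ⊢
    have hm := (m l).isLt
    rcases hpt l with h | h | h
    · omega
    · have hl' : l ∈ Finset.univ.filter (fun l => (m l : ℕ) = 0) := hZ (by simpa using h.1)
      simp only [Finset.mem_filter, Finset.mem_univ, true_and] at hl'
      omega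
    · omega
  refine ⟨hsub, ?_⟩
  have hD : Finset.univ.filter (fun l => (m l : ℕ) = 0) \ Finset.univ.filter (fun l => (v l : ℕ) = 0) =
      Finset.univ.filter (fun l => ((Fin.rev (v l) : Fin (e + 2)) : ℕ) = 0) \
        Finset.univ.filter (fun l => ((Fin.rev (m l) : Fin (e + 2)) : ℕ) = 0) := by
    ext l
    simp only [Finset.mem_sdiff, Finset.mem_filter, Finset.mem_univ, true_and, val_dual_eq]
    have hv := (v l).isLt
    have hm := (m l).isLt
    rcases hpt l with h | h | h <;> omega
  have h1 := Finset.card_sdiff_add_card_eq_card hZ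
  have h2 := Finset.card_sdiff_add_card_eq_card hsub
  rw [hD] at h1
  omega

/-- **(DUAL-ℕ) GORENSTEIN DUALITY OF THE MULTIPLICITIES.** For every `c` and all exponent functions `v, m : Fin k → Fin (e+2)` (no hypothesis):
the multiplicity of `x^v` in `q^c · x^m` EQUALS the multiplicity of `x^{top − m}` in `q^c · x^{top − v}` (`top = (e+1,…,e+1)`, the socle of
`K[x]/(xᵢ^{e+2})`): anchor 229's `count_iterate_colR` on both sides, the label relation is self-dual (`mod_eq_iff_dual`) and duality swaps zero
sets with top sets reversing the inclusion (`zeros_dual`, applied to the pair and to its dual). -/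
theorem count_iterate_colR_dual {k e : ℕ} (c : ℕ) (m v : Fin k → Fin (e + 2)) :
    ((List.flatMap (colR (e + 3)))^[c] [List.ofFn (fun i => (m i : ℕ))]).count (List.ofFn (fun i => (v i : ℕ))) =
      ((List.flatMap (colR (e + 3)))^[c] [List.ofFn (fun i => ((Fin.rev (v i) : Fin (e + 2)) : ℕ))]).count
        (List.ofFn (fun i => ((Fin.rev (m i) : Fin (e + 2)) : ℕ))) := by
  rw [count_iterate_colR c m v, count_iterate_colR c (fun i => Fin.rev (v i)) (fun i => Fin.rev (m i))]
  refine if_congr ⟨fun h => ⟨fun l => (mod_eq_iff_dual (v l) (m l)).mp (h.1 l), zeros_dual v m h.1 h.2.1 h.2.2⟩,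
    fun h => ⟨fun l => (mod_eq_iff_dual (v l) (m l)).mpr (h.1 l), ?_⟩⟩ rfl rfl
  have h2 := zeros_dual (fun i => Fin.rev (m i)) (fun i => Fin.rev (v i)) h.1 h.2.1 h.2.2
  simpa only [Fin.rev_rev] using h2

/-- **(DUAL) THE CENSUS MATRICES ARE A TRANSPOSE PAIR.** For every semiring `R` and all levels `j + j' + c(e+1) = k(e+1)`: the TRANSPOSE of
anchor 229's multiplicity matrix of `×q^c` at level `j` IS its multiplicity matrix at the dual level `j'`, re-indexed along the duality
`v ↦ top − v` of rows and columns (`Matrix.submatrix`; the indices land in the right codegree by `degree_dual_add_degree` and the codegree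
equation of the re-indexed subtype, which `omega` reads off the index).  This is the duality of the graded Gorenstein algebra `K[x]/(xᵢ^{e+2})`,
whose rank shadow `rank(c, j) = rank(c, j')` anchor 312 (`…UnitColumnRankLevelSymmetry`, PROBE 20) computed from anchor 294's block formula;
entry by entry it is (DUAL-ℕ). -/
theorem transpose_eq_dual (R : Type*) [Semiring R] (k e c j j' : ℕ) (hjj : j + j' + c * (e + 1) = k * (e + 1)) :
    (Matrix.of fun (v : {v : Fin k → Fin (e + 2) // (∑ i, (v i : ℕ)) + j = k * (e + 1)})
        (m : {m : Fin k → Fin (e + 2) // (∑ i, (m i : ℕ)) + (j + c * (e + 1)) = k * (e + 1)}) =>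
      ((((List.flatMap (colR (e + 3)))^[c] [List.ofFn (fun i => (m.1 i : ℕ))]).count (List.ofFn (fun i => (v.1 i : ℕ))) : ℕ) : R)).transpose =
    (Matrix.of fun (v : {v : Fin k → Fin (e + 2) // (∑ i, (v i : ℕ)) + j' = k * (e + 1)})
        (m : {m : Fin k → Fin (e + 2) // (∑ i, (m i : ℕ)) + (j' + c * (e + 1)) = k * (e + 1)}) =>
      ((((List.flatMap (colR (e + 3)))^[c] [List.ofFn (fun i => (m.1 i : ℕ))]).count (List.ofFn (fun i => (v.1 i : ℕ))) : ℕ) : R)).submatrix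
      (fun m => ⟨fun l => Fin.rev (m.1 l), by have h := degree_dual_add_degree m.1; dsimp only; omega⟩)
      (fun v => ⟨fun l => Fin.rev (v.1 l), by have h := degree_dual_add_degree v.1; dsimp only; omega⟩) := by
  ext m v
  rw [Matrix.transpose_apply, Matrix.submatrix_apply, Matrix.of_apply, Matrix.of_apply, count_iterate_colR_dual c m.1 v.1]

end Summit.HodgeConjecture.HodgeConjecture.HodgeLocus.Census.UnitColumnChain
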